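import Literature.MathematicalPhysics.QuantumLattice.HubbardGridFlowClosure
import Literature.MathematicalPhysics.QuantumLattice.GrassmannTwoPointEffectiveAction
import HarnessLib

/-!
# The grid two-point function of the Hubbard torus at `βU ≤ κ` is bounded uniformly in `β`, `L`, `M`

Topic `MathematicalPhysics/QuantumLattice`; cell gate-hubbard-kl, R0-SCOPE-4 P6 (assembly).  For a valid run `S` (`FlowSetup.Valid`) with
grid covariance `C = Sᵀ C^θ S = Σ_{j ≤ K} C_j` and interaction `V = uV₁ + ν₀N₂`, the two-point function
`⟨ψ_X ψ_Y e^{-V}⟩_C / Z` is bounded by `GrassmannTwoPointEffectiveAction.norm_gaussExpect_twoPoint_le` with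
* the sup of the pair function `a = Σ_j κ_j² ≤ κ₀² + 2AΛ₀` (each `C_j` is replica-Gram bounded: `IsGramBoundedR.norm_pairing_le`),
* its row sums `α = Σ_j α_j ≤ (N/β)(C_uv + 2C_sl(β/π)^{3/2})`,
* the pinned quadratic kernel of the effective action `w = 2(D_{K+1}t_{K+1}² + ‖ν_{K+1}‖β/N)` (the flow, `FlowSetup.Valid.flow`, plus
  `sum_norm_kernel_gridTracked_le`),
and `α w` is bounded uniformly in `β ≥ 1`, `L`, `M`, `N` (`FlowSetup.Valid.alpha_mul_w_le`), whence
**`FlowSetup.Valid.norm_twoPoint_div_le`**: `‖⟨ψ_Xψ_Y e^{-V}⟩_C/Z‖ ≤ Mb`, `Mb = (κ₀² + 2AΛ₀)(1 + 2(2π^{3/2}C_uv/(29C_sl) + 4/29 + πκ_UC_uv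
+ 2κ_UC_sl/√π))` (Benfatto–Giuliani–Mastropietro 2006, Thm 2.1 / §2.9: the Schwinger functions are bounded uniformly in the volume
and in the temperature in the analyticity domain).

Everything is proved; `FlowSetup.Mb` is the only definition; no named facts.

## Sources

G. Benfatto, A. Giuliani, V. Mastropietro, Ann. Henri Poincaré 7 (2006) 809–898, Thm 2.1, §2.9 (2.90)–(2.92) (`BenfattoGiulianiMastropietro2006`).
-/

noncomputable section

namespace Literature.MathematicalPhysics.QuantumLattice

open Literature.Probability.LatticeModels GrassmannAlgebra Finset Complex
open scoped InnerProductSpace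

/-! ### Generic: pairings of a replica-Gram-bounded covariance, pinned sums in degree two -/

section Generic

universe u

variable {𝕜 : Type*} [RCLike 𝕜] {Γ : Type u} [Fintype Γ] [DecidableEq Γ]

/-- **The pair function of a replica-Gram-bounded covariance is bounded by `κ²`.** [cite: BenfattoGiulianiMastropietro2006, (2.80)] -/
theorem IsGramBoundedR.norm_pairing_le {C : Matrix Γ Γ 𝕜} {κ : ℝ} (h : IsGramBoundedR C κ) (X Y : Γ) :
    ‖((1 / 2 : ℚ) • (1 : 𝕜)) * (C Y X - C X Y)‖ ≤ κ ^ 2 := by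
  set U : Γ → EuclideanSpace ℝ (Fin 1) := fun _ => EuclideanSpace.single 0 1 with hU
  have hUn : ∀ X, ‖U X‖ ≤ 1 := fun X => by simp [hU]
  have hW : gramWeighted U C = C := by
    ext X' Y'
    rw [gramWeighted_apply]
    simp [hU]
  have hg := h.isGramBounded 1 U hUn 2 ![X, Y]
  rw [hW] at hg
  have hprod : genProd 𝕜 ![X, Y] = gen 𝕜 X * gen 𝕜 Y := by
    simp [genProd, List.ofFn_succ]
  rw [hprod, gaussExpect_gen_mul_gen] at hg
  exact hg

omit [DecidableEq Γ] in
/-- A pinned sum over two labels is a plain sum over the free label. [cite: BenfattoGiulianiMastropietro2006, §2.8 (2.86)] -/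
theorem sum_filter_fin_two_eq {E : Type*} [AddCommMonoid E] (f : (Fin 2 → Γ) → E) (w : Γ) [DecidableEq Γ] :
    ∑ Y ∈ univ.filter (fun Y : Fin 2 → Γ => Y 0 = w), f Y = ∑ X' : Γ, f ![w, X'] := by
  rw [sum_filter]
  rw [← (finTwoArrowEquiv Γ).symm.sum_comp]
  simp only [finTwoArrowEquiv_symm_apply, Matrix.cons_val_zero, Fintype.sum_prod_type]
  simp

omit [Fintype Γ] [DecidableEq Γ] in
/-- `constPart(∂_{X′} ∂_{Y′} W) = 2·kernel₂ W (Y′, X′)`. [cite: Salmhofer1999, §4.3 (4.90)] -/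
theorem constPart_deriv_deriv_eq_two_mul_kernel {R : Type*} [CommRing R] [Algebra ℚ R] (W : GrassmannAlgebra R Γ) (X' Y' : Γ) :
    constPart R (grassmannDeriv R X' (grassmannDeriv R Y' W)) = 2 * kernel R W 2 ![Y', X'] := by
  rw [kernel_def]
  have h2 : iterDeriv R ![Y', X'] W = grassmannDeriv R X' (grassmannDeriv R Y' W) := by
    simp [iterDeriv, List.ofFn_succ]
  rw [h2, Nat.factorial_two]
  rw [← mul_assoc]
  have : (2 : R) * (((2 : ℕ) : ℚ)⁻¹ • (1 : R)) = 1 := by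
    rw [mul_smul_comm, mul_one, show (2 : R) = ((2 : ℚ) • (1 : R)) by rw [← map_ofNat (algebraMap ℚ R) 2, Algebra.algebraMap_eq_smul_one],
      smul_smul]
    norm_num
  rw [this, one_mul]

end Generic

/-! ### The two-point bound of a valid run -/

namespace FlowSetup

variable {L M N : ℕ} [NeZero L] [NeZero N] (S : FlowSetup L M N)

/-- **The uniform bound of the two-point function.** [cite: BenfattoGiulianiMastropietro2006, Thm 2.1] -/
def Mb : ℝ := (S.κ₀ ^ 2 + 2 * S.A * S.Λ₀) *
  (1 + 2 * (2 * Real.pi * Real.sqrt Real.pi * S.Cuv / (29 * S.Csl) + 4 / 29 + Real.pi * S.κU * S.Cuv + 2 * S.κU * S.Csl / Real.sqrt Real.pi))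

/-- The full grid covariance. [cite: BenfattoGiulianiMastropietro2006, §2.2 (2.12)] -/
abbrev covFull : Matrix (GridLeg (GridPoint L N)) (GridLeg (GridPoint L N)) ℂ :=
  (hubbardGridSub L M S.β N).transpose * hubbardCovFullShifted L M S.β S.μR S.θ * hubbardGridSub L M S.β N

variable {S}

omit [NeZero N] in
/-- **The pair function of the full covariance is bounded**: `|A(X,Y)| ≤ Σ_{j≤K} κ_j² ≤ κ₀² + 2AΛ₀`.
[cite: BenfattoGiulianiMastropietro2006, (2.80)] -/
theorem Valid.norm_pairing_full_le (h : S.Valid) (X Y : GridLeg (GridPoint L N)) :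
    ‖((1 / 2 : ℚ) • (1 : ℂ)) * (S.covFull Y X - S.covFull X Y)‖ ≤ S.κ₀ ^ 2 + 2 * S.A * S.Λ₀ := by
  have hβ := h.β_pos
  rw [covFull, ← sum_gridScaleCov hβ S.μR S.θ S.Λ₀ flowR h.K_ne_zero]
  rw [Matrix.sum_apply, Matrix.sum_apply, ← Finset.sum_sub_distrib, Finset.mul_sum]
  refine (norm_sum_le _ _).trans ?_
  have hterm : ∀ j ∈ range (S.K + 1), ‖((1 / 2 : ℚ) • (1 : ℂ)) * (S.cov j Y X - S.cov j X Y)‖ ≤ S.kap j ^ 2 := fun j _ =>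
    (h.gram j).norm_pairing_le X Y
  refine (sum_le_sum hterm).trans ?_
  rw [sum_range_succ']
  have h0 : S.kap 0 ^ 2 = S.κ₀ ^ 2 := by simp [kap, flowKap]
  rw [h0, add_comm]
  refine add_le_add le_rfl ?_
  have hk : ∀ j ∈ range S.K, S.kap (j + 1) ^ 2 = S.A * S.scale (j + 1) := fun j hj =>
    flowKap_sq h.A_pos.le hβ (Nat.succ_ne_zero j) (by have := mem_range.1 hj; omega)
  rw [sum_congr rfl hk, ← mul_sum]
  have hK : 1 ≤ S.K := Nat.one_le_iff_ne_zero.2 h.K_ne_zero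
  have htail := sum_gridScale_tail_le hβ S.Λ₀ one_ne_zero hK
  have hre : ∑ j ∈ range S.K, S.scale (j + 1) = ∑ i ∈ Finset.Icc 1 S.K, S.scale i := by
    rw [Finset.range_eq_Ico, Finset.sum_Ico_add' (fun i => S.scale i) 0 S.K 1]
    simp only [zero_add]
    rfl
  rw [hre]
  have h2 : ∑ i ∈ Finset.Icc 1 S.K, S.scale i ≤ 2 * S.Λ₀ := htail.trans (by linarith [h.top_le])
  calc S.A * ∑ i ∈ Finset.Icc 1 S.K, S.scale i ≤ S.A * (2 * S.Λ₀) := mul_le_mul_of_nonneg_left h2 h.A_pos.le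
    _ = 2 * S.A * S.Λ₀ := by ring

omit [NeZero N] in
/-- **The row sums of the pair function of the full covariance**: `Σ_{Y′} |A(X,Y′)| ≤ Σ_{j≤K} α_j`.
[cite: BenfattoGiulianiMastropietro2006, (2.81)] -/
theorem Valid.sum_norm_pairing_full_le (h : S.Valid) (X : GridLeg (GridPoint L N)) :
    ∑ Y', ‖((1 / 2 : ℚ) • (1 : ℂ)) * (S.covFull Y' X - S.covFull X Y')‖ ≤ ∑ j ∈ range (S.K + 1), S.alp j := by
  have hβ := h.β_pos
  have hhalf : ‖((1 / 2 : ℚ) • (1 : ℂ))‖ = 1 / 2 := by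
    rw [show ((1 / 2 : ℚ) • (1 : ℂ)) = (1 / 2 : ℂ) by rw [Rat.smul_one_eq_cast]; push_cast; ring]
    simp
  have hrow : ∑ Y', ‖S.covFull X Y'‖ ≤ ∑ j ∈ range (S.K + 1), S.alp j := by
    rw [covFull, ← sum_gridScaleCov hβ S.μR S.θ S.Λ₀ flowR h.K_ne_zero]
    calc ∑ Y', ‖(∑ j ∈ range (S.K + 1), S.cov j) X Y'‖ ≤ ∑ Y', ∑ j ∈ range (S.K + 1), ‖S.cov j X Y'‖ :=
          sum_le_sum fun Y' _ => by rw [Matrix.sum_apply]; exact norm_sum_le _ _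
      _ = ∑ j ∈ range (S.K + 1), ∑ Y', ‖S.cov j X Y'‖ := sum_comm
      _ ≤ ∑ j ∈ range (S.K + 1), S.alp j := sum_le_sum fun j _ => h.rows j X
  have hcol : ∑ Y', ‖S.covFull Y' X‖ ≤ ∑ j ∈ range (S.K + 1), S.alp j := by
    rw [covFull, ← sum_gridScaleCov hβ S.μR S.θ S.Λ₀ flowR h.K_ne_zero]
    calc ∑ Y', ‖(∑ j ∈ range (S.K + 1), S.cov j) Y' X‖ ≤ ∑ Y', ∑ j ∈ range (S.K + 1), ‖S.cov j Y' X‖ :=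
          sum_le_sum fun Y' _ => by rw [Matrix.sum_apply]; exact norm_sum_le _ _
      _ = ∑ j ∈ range (S.K + 1), ∑ Y', ‖S.cov j Y' X‖ := sum_comm
      _ ≤ ∑ j ∈ range (S.K + 1), S.alp j := sum_le_sum fun j _ => h.cols j X
  calc ∑ Y', ‖((1 / 2 : ℚ) • (1 : ℂ)) * (S.covFull Y' X - S.covFull X Y')‖
      ≤ ∑ Y', 1 / 2 * (‖S.covFull Y' X‖ + ‖S.covFull X Y'‖) := sum_le_sum fun Y' _ => by
        rw [norm_mul, hhalf]; exact mul_le_mul_of_nonneg_left (norm_sub_le _ _) (by norm_num)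
    _ = 1 / 2 * (∑ Y', ‖S.covFull Y' X‖ + ∑ Y', ‖S.covFull X Y'‖) := by
        simp only [mul_add, Finset.sum_add_distrib, Finset.mul_sum]
    _ ≤ 1 / 2 * (∑ j ∈ range (S.K + 1), S.alp j + ∑ j ∈ range (S.K + 1), S.alp j) := by gcongr
    _ = ∑ j ∈ range (S.K + 1), S.alp j := by ring

/-- **The total row-sum constant**: `Σ_{j≤K} α_j ≤ (N/β)(C_uv + 2C_sl (β/π)^{3/2})`. [cite: BenfattoGiulianiMastropietro2006, (2.81)] -/
theorem Valid.sum_alp_le (h : S.Valid) :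
    ∑ j ∈ range (S.K + 1), S.alp j ≤ N / S.β * (S.Cuv + 2 * S.Csl * (S.β / Real.pi * Real.sqrt (S.β / Real.pi))) := by
  have hβ := h.β_pos
  have hN : (0 : ℝ) < N := by exact_mod_cast Nat.pos_of_ne_zero (NeZero.ne N)
  rw [sum_range_succ']
  have h0 : S.alp 0 = S.Cuv * (N / S.β) := by simp [alp]
  -- the slices: `α_{j} = C_sl (N/β) Λ_j^{-3/2}`, `Λ_j = (π/β) r^{K-j}`, `Σ_j Λ_j^{-3/2} ≤ 2 (β/π)^{3/2}`
  have hsq : 1 / Real.sqrt (Real.pi / S.β) = Real.sqrt (S.β / Real.pi) := by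
    rw [one_div, ← Real.sqrt_inv, inv_div]
  have hj : ∀ j ∈ range S.K, S.alp (j + 1) ≤ S.Csl * (N / S.β) * (S.β / Real.pi * Real.sqrt (S.β / Real.pi)) * (1 / 2) ^ (S.K - 1 - j) := by
    intro j hjm
    have hjK : j + 1 ≤ S.K := by have := mem_range.1 hjm; omega
    have hΛ := h.scale_pos (j + 1)
    simp only [alp, Nat.succ_ne_zero, if_false, if_pos hjK]
    set n := S.K - (j + 1) with hn
    have hn' : S.K - 1 - j = n := by omega
    rw [hn']
    have hscale : S.scale (j + 1) = Real.pi / S.β * flowR ^ n := by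
      rw [scale, gridScale_of_ne_zero S.β S.Λ₀ flowR S.K (Nat.succ_ne_zero j)]
    have h2n : (2 : ℝ) ^ n ≤ flowR ^ n := pow_le_pow_left₀ (by norm_num) two_le_flowR n
    have hπβ : 0 < Real.pi / S.β := by positivity
    have hlow : Real.pi / S.β * 2 ^ n * Real.sqrt (Real.pi / S.β) ≤ S.scale (j + 1) * Real.sqrt (S.scale (j + 1)) := by
      have h1 : Real.pi / S.β * 2 ^ n ≤ S.scale (j + 1) := by rw [hscale]; exact mul_le_mul_of_nonneg_left h2n hπβ.le
      have h2 : Real.sqrt (Real.pi / S.β) ≤ Real.sqrt (S.scale (j + 1)) :=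
        Real.sqrt_le_sqrt (pi_div_le_gridScale hβ S.Λ₀ S.K (Nat.succ_ne_zero j))
      exact mul_le_mul h1 h2 (Real.sqrt_nonneg _) hΛ.le
    have hpos : 0 < Real.pi / S.β * 2 ^ n * Real.sqrt (Real.pi / S.β) := by positivity
    have hC : 0 ≤ S.Csl * (N / S.β) := by have := h.Csl_pos; positivity
    calc S.Csl * (N / S.β) / (S.scale (j + 1) * Real.sqrt (S.scale (j + 1)))
        ≤ S.Csl * (N / S.β) / (Real.pi / S.β * 2 ^ n * Real.sqrt (Real.pi / S.β)) := div_le_div_of_nonneg_left hC hpos hlow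
      _ = S.Csl * (N / S.β) * (S.β / Real.pi * (1 / Real.sqrt (Real.pi / S.β))) * (1 / 2) ^ n := by
          have : Real.sqrt (Real.pi / S.β) ≠ 0 := (Real.sqrt_pos.2 hπβ).ne'
          have h2n0 : (2 : ℝ) ^ n ≠ 0 := pow_ne_zero _ two_ne_zero
          rw [one_div_pow]
          field_simp
      _ = S.Csl * (N / S.β) * (S.β / Real.pi * Real.sqrt (S.β / Real.pi)) * (1 / 2) ^ n := by rw [hsq]
  have hgeom : ∑ j ∈ range S.K, (1 / 2 : ℝ) ^ (S.K - 1 - j) ≤ 2 := by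
    rw [Finset.sum_range_reflect (fun m => (1 / 2 : ℝ) ^ m) S.K]; exact sum_geometric_two_le S.K
  calc ∑ j ∈ range S.K, S.alp (j + 1) + S.alp 0
      ≤ ∑ j ∈ range S.K, S.Csl * (N / S.β) * (S.β / Real.pi * Real.sqrt (S.β / Real.pi)) * (1 / 2) ^ (S.K - 1 - j) + S.Cuv * (N / S.β) := by
        rw [h0]; exact add_le_add (sum_le_sum hj) le_rfl
    _ = S.Csl * (N / S.β) * (S.β / Real.pi * Real.sqrt (S.β / Real.pi)) * ∑ j ∈ range S.K, (1 / 2 : ℝ) ^ (S.K - 1 - j) + S.Cuv * (N / S.β) := by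
        rw [mul_sum]
    _ ≤ S.Csl * (N / S.β) * (S.β / Real.pi * Real.sqrt (S.β / Real.pi)) * 2 + S.Cuv * (N / S.β) := by
        have : 0 ≤ S.Csl * (N / S.β) * (S.β / Real.pi * Real.sqrt (S.β / Real.pi)) := by have := h.Csl_pos; positivity
        nlinarith
    _ = N / S.β * (S.Cuv + 2 * S.Csl * (S.β / Real.pi * Real.sqrt (S.β / Real.pi))) := by ring

/-- **The pinned quadratic kernel of the full effective action**: for every `Y′`,
`Σ_{X′} ‖constPart(∂_{X′}∂_{Y′} W)‖ ≤ 2 (D_{K+1} t_{K+1}² + ‖ν_{K+1}‖ β/N)`. [cite: BenfattoGiulianiMastropietro2006, §2.8 (2.88)] -/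
theorem Valid.sum_norm_kernelTwo_effAction_le (h : S.Valid) (Y' : GridLeg (GridPoint L N)) :
    ∑ X', ‖constPart ℂ (grassmannDeriv ℂ X' (grassmannDeriv ℂ Y' (effAction ℂ S.covFull S.V)))‖ ≤
      2 * (S.D (S.K + 1) * S.t (S.K + 1) ^ 2 + ‖S.nu (S.K + 1)‖ * (S.β / N)) := by
  have hβ := h.β_pos
  obtain ⟨hW, -⟩ := h.effAction_full_eq
  rw [covFull, hW]
  obtain ⟨-, -, -, hker⟩ := h.flow (S.K + 1) le_rfl
  have hH := hker 2 two_pos 0 Y'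
  rw [sum_filter_fin_two_eq] at hH
  have hL := sum_norm_kernel_gridTracked_le (L := L) hβ.le S.u (S.nu (S.K + 1)) 2 0 Y'
  rw [sum_filter_fin_two_eq] at hL
  have hNL : gridTrackedNL N S.β S.u (S.nu (S.K + 1)) 2 = ‖S.nu (S.K + 1)‖ * (S.β / N) := by simp [gridTrackedNL]
  rw [hNL] at hL
  simp_rw [constPart_deriv_deriv_eq_two_mul_kernel]
  calc ∑ X', ‖(2 : ℂ) * kernel ℂ (iterEffAction ℂ S.cov (S.K + 1) S.V) 2 ![Y', X']‖
      = 2 * ∑ X', ‖kernel ℂ (iterEffAction ℂ S.cov (S.K + 1) S.V) 2 ![Y', X']‖ := by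
        rw [mul_sum]; exact sum_congr rfl fun X' _ => by rw [norm_mul, Complex.norm_ofNat]
    _ ≤ 2 * (∑ X', ‖kernel ℂ (iterEffAction ℂ S.cov (S.K + 1) S.V - S.Lj (S.K + 1)) 2 ![Y', X']‖ +
          ∑ X', ‖kernel ℂ (S.Lj (S.K + 1)) 2 ![Y', X']‖) := by
        rw [← sum_add_distrib]
        refine mul_le_mul_of_nonneg_left (sum_le_sum fun X' _ => ?_) (by norm_num)
        have : kernel ℂ (iterEffAction ℂ S.cov (S.K + 1) S.V) 2 ![Y', X'] =
            kernel ℂ (iterEffAction ℂ S.cov (S.K + 1) S.V - S.Lj (S.K + 1)) 2 ![Y', X'] + kernel ℂ (S.Lj (S.K + 1)) 2 ![Y', X'] := by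
          rw [← kernel_add, sub_add_cancel]
        rw [this]; exact norm_add_le _ _
    _ ≤ 2 * (S.D (S.K + 1) * S.t (S.K + 1) ^ 2 + ‖S.nu (S.K + 1)‖ * (S.β / N)) := by
        exact mul_le_mul_of_nonneg_left (add_le_add hH hL) (by norm_num)

/-- **`α · w` is bounded uniformly in `β ≥ 1`, `L`, `M`, `N`.** [cite: BenfattoGiulianiMastropietro2006, Thm 2.1] -/
theorem Valid.alpha_mul_w_le (h : S.Valid) :
    (∑ j ∈ range (S.K + 1), S.alp j) * (2 * (S.D (S.K + 1) * S.t (S.K + 1) ^ 2 + ‖S.nu (S.K + 1)‖ * (S.β / N))) ≤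
      2 * (2 * Real.pi * Real.sqrt Real.pi * S.Cuv / (29 * S.Csl) + 4 / 29 + Real.pi * S.κU * S.Cuv + 2 * S.κU * S.Csl / Real.sqrt Real.pi) := by
  have hβ := h.β_pos
  have hβ1 := h.one_le_β
  have hN : (0 : ℝ) < N := by exact_mod_cast Nat.pos_of_ne_zero (NeZero.ne N)
  have hCsl := h.Csl_pos; have hCuv := h.Cuv_pos; have hκU := h.κU_nonneg
  have hα := h.sum_alp_le
  have hα0 : 0 ≤ ∑ j ∈ range (S.K + 1), S.alp j := sum_nonneg fun j _ => (h.alp_pos j).le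
  have hDt := h.D_last_mul_t_sq_le
  have hν : ‖S.nu (S.K + 1)‖ ≤ ‖S.u‖ * (Real.pi / S.β) := by
    have := h.res; simpa [nu, flowNu] using this
  have hu := h.u_le
  -- abbreviations
  set αt := ∑ j ∈ range (S.K + 1), S.alp j with hαt
  set B := S.β / Real.pi * Real.sqrt (S.β / Real.pi) with hB
  have hB0 : 0 ≤ B := by rw [hB]; positivity
  have hsβ : Real.sqrt (S.β / Real.pi) * Real.sqrt (Real.pi / S.β) = 1 := by
    rw [← Real.sqrt_mul (by positivity), div_mul_div_cancel₀ (Real.pi_pos.ne'), div_self hβ.ne', Real.sqrt_one]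
  -- term 1: `αt · 2 D t² ≤ 2 (N/β)(Cuv + 2 Csl B)(1/29) π √(π/β)/(Csl N)`
  have h1 : αt * (S.D (S.K + 1) * S.t (S.K + 1) ^ 2) ≤
      2 * Real.pi * Real.sqrt Real.pi * S.Cuv / (29 * S.Csl) / 2 + 4 / 29 / 2 := by
    have hDt0 : 0 ≤ S.D (S.K + 1) * S.t (S.K + 1) ^ 2 := mul_nonneg (h.D_nonneg _) (sq_nonneg _)
    calc αt * (S.D (S.K + 1) * S.t (S.K + 1) ^ 2)
        ≤ (N / S.β * (S.Cuv + 2 * S.Csl * B)) * (1 / 29 * (Real.pi * Real.sqrt (Real.pi / S.β) / (S.Csl * N))) :=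
          mul_le_mul hα hDt hDt0 (by positivity)
      _ = 1 / 29 * Real.pi * (S.Cuv / S.Csl) * (Real.sqrt (Real.pi / S.β) / S.β) +
          2 / 29 * Real.pi * (B * Real.sqrt (Real.pi / S.β) / S.β) := by
          field_simp
      _ ≤ 1 / 29 * Real.pi * (S.Cuv / S.Csl) * Real.sqrt Real.pi + 2 / 29 * Real.pi * (1 / Real.pi) := by
          have hsq1 : Real.sqrt (Real.pi / S.β) ≤ Real.sqrt Real.pi := Real.sqrt_le_sqrt (div_le_self Real.pi_pos.le hβ1)
          have ha : Real.sqrt (Real.pi / S.β) / S.β ≤ Real.sqrt Real.pi :=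
            (div_le_self (Real.sqrt_nonneg _) hβ1).trans hsq1
          have hb : B * Real.sqrt (Real.pi / S.β) / S.β = 1 / Real.pi := by
            rw [hB, mul_assoc, hsβ]; field_simp
          rw [hb]
          gcongr
      _ = 2 * Real.pi * Real.sqrt Real.pi * S.Cuv / (29 * S.Csl) / 2 + 4 / 29 / 2 := by field_simp; ring
  -- term 2: `αt · ‖ν‖ β/N ≤ π κU Cuv/β² + 2 κU Csl/√(πβ)`
  have h2 : αt * (‖S.nu (S.K + 1)‖ * (S.β / N)) ≤ (Real.pi * S.κU * S.Cuv + 2 * S.κU * S.Csl / Real.sqrt Real.pi) / 1 := by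
    have hν' : ‖S.nu (S.K + 1)‖ ≤ S.κU / S.β * (Real.pi / S.β) := hν.trans (mul_le_mul_of_nonneg_right hu (by positivity))
    have hn0 : 0 ≤ ‖S.nu (S.K + 1)‖ * (S.β / N) := by positivity
    calc αt * (‖S.nu (S.K + 1)‖ * (S.β / N)) ≤ (N / S.β * (S.Cuv + 2 * S.Csl * B)) * (S.κU / S.β * (Real.pi / S.β) * (S.β / N)) :=
          mul_le_mul hα (mul_le_mul_of_nonneg_right hν' (by positivity)) hn0 (by positivity)
      _ = Real.pi * S.κU * S.Cuv / S.β ^ 2 + 2 * S.κU * S.Csl * (Real.pi * B / S.β ^ 2) := by field_simp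
      _ ≤ Real.pi * S.κU * S.Cuv / 1 + 2 * S.κU * S.Csl * (1 / Real.sqrt Real.pi) := by
          have hb : Real.pi * B / S.β ^ 2 = Real.sqrt (S.β / Real.pi) / S.β := by rw [hB]; field_simp
          have hb' : Real.sqrt (S.β / Real.pi) / S.β ≤ 1 / Real.sqrt Real.pi := by
            rw [div_le_div_iff₀ hβ (Real.sqrt_pos.2 Real.pi_pos), one_mul, ← Real.sqrt_mul (by positivity)]
            calc Real.sqrt (S.β / Real.pi * Real.pi) = Real.sqrt S.β := by rw [div_mul_cancel₀ _ Real.pi_pos.ne']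
              _ ≤ S.β := by
                  rw [Real.sqrt_le_left (by linarith)]; nlinarith
          rw [hb]
          have hβ2 : (1 : ℝ) ≤ S.β ^ 2 := by nlinarith
          gcongr
      _ = (Real.pi * S.κU * S.Cuv + 2 * S.κU * S.Csl / Real.sqrt Real.pi) / 1 := by ring
  calc αt * (2 * (S.D (S.K + 1) * S.t (S.K + 1) ^ 2 + ‖S.nu (S.K + 1)‖ * (S.β / N)))
      = 2 * (αt * (S.D (S.K + 1) * S.t (S.K + 1) ^ 2) + αt * (‖S.nu (S.K + 1)‖ * (S.β / N))) := by ring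
    _ ≤ 2 * ((2 * Real.pi * Real.sqrt Real.pi * S.Cuv / (29 * S.Csl) / 2 + 4 / 29 / 2) +
          (Real.pi * S.κU * S.Cuv + 2 * S.κU * S.Csl / Real.sqrt Real.pi) / 1) := by gcongr
    _ ≤ _ := by
        have : 0 ≤ 2 * Real.pi * Real.sqrt Real.pi * S.Cuv / (29 * S.Csl) := by positivity
        nlinarith [Real.pi_pos, hκU, hCuv.le, hCsl.le, Real.sqrt_nonneg Real.pi,
          div_nonneg (mul_nonneg (mul_nonneg zero_le_two hκU) hCsl.le) (Real.sqrt_nonneg Real.pi)]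

/-- **The two-point function of the interacting grid measure is bounded uniformly** in `β ≥ 1`, `L`, `M`, `N`:
`‖⟨ψ_X ψ_Y e^{-V}⟩_C / Z‖ ≤ Mb`. [cite: BenfattoGiulianiMastropietro2006, Thm 2.1] -/
theorem Valid.norm_twoPoint_div_le (h : S.Valid) (X Y : GridLeg (GridPoint L N)) :
    ‖gaussExpect ℂ S.covFull (gen ℂ X * gen ℂ Y * grassmannExp (-S.V)) / effPartitionFn ℂ S.covFull S.V‖ ≤ S.Mb := by
  obtain ⟨-, hZ⟩ := h.effAction_full_eq
  have hZ0 : effPartitionFn ℂ S.covFull S.V ≠ 0 := hZ.ne_zero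
  have ha : 0 ≤ S.κ₀ ^ 2 + 2 * S.A * S.Λ₀ := by have := h.A_pos; have := h.Λ₀_pos; positivity
  have hw : 0 ≤ 2 * (S.D (S.K + 1) * S.t (S.K + 1) ^ 2 + ‖S.nu (S.K + 1)‖ * (S.β / N)) := by
    have := h.D_nonneg (S.K + 1); have := h.β_pos; positivity
  have hmain := norm_gaussExpect_twoPoint_le S.covFull (gridTracked_mem_evenPart _ _ _) (constPart_gridTracked _ _ _) hZ X Y ha hw
    h.norm_pairing_full_le (h.sum_norm_pairing_full_le X) h.sum_norm_kernelTwo_effAction_le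
  rw [norm_div, div_le_iff₀ (norm_pos_iff.2 hZ0)]
  refine hmain.trans ?_
  rw [mul_comm]
  refine mul_le_mul_of_nonneg_right ?_ (norm_nonneg _)
  rw [Mb]
  refine mul_le_mul_of_nonneg_left ?_ ha
  have := h.alpha_mul_w_le
  linarith

end FlowSetup

end Literature.MathematicalPhysics.QuantumLattice

end
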